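import Literature.AlgebraicGeometry.Frobenioids.CircleOpensSubarcs
import HarnessLib

/-!
# Frobenioids II, Lemma 3.2: proof of (ii), second sentence

Mochizuki, *The geometry of Frobenioids II*, Kyushu J. Math. **62** (2008) 401–460, §3, Lemma 3.2
(ii) p. 25 [cite: MochizukiFrdII2008, Lem 3.2 (ii) p.25]. Discharge (proof-only companion) of the
named fact `ItemII_roots` of `CircleOpens.lean` (abc-iut-L1-t4): "for `n` a positive integer,
there exists a [nonempty] connected open subset `A′ ⊆ A` such that `φ_{-1}(A′) = w · A′`, where
`wⁿ = 1`, if and only if `φ_n(A) ∩ {1, −1} ≠ ∅`."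

Proof notes. (⇐): if `z = exp(it) ∈ A` with `zⁿ = ±1`, a small arc `A′ = exp(i·(t-ε, t+ε)) ⊆ A`
satisfies `φ_{-1}(A′) = exp(-2it) · A′` and `exp(-2it)ⁿ = z^{-2n} = 1`. (⇒): if `A′ = S¹` then
`1 ∈ φ_n(A) = S¹`; otherwise `A′ = exp(i·(a, b))`, and `φ_{-1}(A′) = exp(i·(-b, -a))` equals
`w · A′ = exp(i·(s+a, s+b))` (`w = exp(is)`) only if `s ≡ -(a+b) (mod 2π)` (integer shift of
sub-arcs); then `wⁿ = 1` gives `n(a+b) ∈ 2πℤ`, so the midpoint `m = (a+b)/2 ∈ A′ ⊆ A` has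
`φ_n(exp(im)) = exp(iπj) = (−1)ʲ ∈ {1, −1}`.
-/

namespace Literature.AlgebraicGeometry.Frobenioids

open Set Function Topology Real
open scoped Pointwise

noncomputable section

namespace CircleOpens

/-- `x ↦ -x` on open intervals. [cite: MochizukiFrdII2008, Lem 3.2 (ii) p.25] -/
private theorem image_neg_one_mul_Ioo' (a b : ℝ) :
    (fun x => (-1 : ℝ) * x) '' Ioo a b = Ioo (-b) (-a) := by
  ext y
  constructor
  · rintro ⟨x, hx, rfl⟩
    exact ⟨by linarith [hx.2], by linarith [hx.1]⟩
  · intro hy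
    exact ⟨-y, ⟨by linarith [hy.2], by linarith [hy.1]⟩, by ring⟩

/-- `exp(iπ) = -1`. [cite: MochizukiFrdII2008, Lem 3.2 (ii) p.25] -/
theorem exp_pi_eq_neg_one : Circle.exp π = -1 := by
  apply Circle.coe_injective
  rw [Circle.coe_exp]
  push_cast
  rw [Complex.exp_pi_mul_I]

/-- `exp(iπj) ∈ {1, -1}` for `j ∈ ℤ`. [cite: MochizukiFrdII2008, Lem 3.2 (ii) p.25] -/
theorem exp_int_mul_pi_mem (j : ℤ) : Circle.exp (j * π) ∈ ({1, -1} : Set Circle) := by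
  rw [← zsmul_eq_mul, Circle.exp_zsmul, exp_pi_eq_neg_one]
  rcases Int.even_or_odd j with hj | hj
  · exact Or.inl hj.neg_one_zpow
  · exact Or.inr hj.neg_one_zpow

/-- A point of an open `A ⊆ S¹` is the centre of an open arc inside `A`.
[cite: MochizukiFrdII2008, Lem 3.2 (ii) p.25] -/
theorem exists_arc_subset {A : Set Circle} (hA : IsOpen A) {t : ℝ} (ht : Circle.exp t ∈ A) :
    ∃ ε : ℝ, 0 < ε ∧ Circle.exp '' Ioo (t - ε) (t + ε) ⊆ A := by
  have hpre : IsOpen (Circle.exp ⁻¹' A) := hA.preimage Circle.exp.continuous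
  obtain ⟨ε, hε, hball⟩ := Metric.isOpen_iff.mp hpre t ht
  refine ⟨ε, hε, ?_⟩
  rintro _ ⟨x, hx, rfl⟩
  apply hball
  rw [Real.ball_eq_Ioo]
  exact hx

/-- **Lemma 3.2 (ii)**, second sentence (FrdII p. 25), PROVED.
[cite: MochizukiFrdII2008, Lem 3.2 (ii) p.25] -/
theorem ItemII_roots_holds : ItemII_roots := by
  intro A hA hAo n hn
  have hn0 : ((n : ℤ) : ℝ) ≠ 0 := by exact_mod_cast hn.ne'
  constructor
  · rintro ⟨A', hA', hA'o, hA'A, w, hwn, hsym⟩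
    by_cases hU : A' = univ
    · have hAu : A = univ := univ_subset_iff.mp (hU ▸ hA'A)
      refine ⟨1, ?_, Or.inl rfl⟩
      rw [hAu, phi_image_univ (by exact_mod_cast hn.ne')]
      exact mem_univ _
    · obtain ⟨a, b, hab, hlen, rfl⟩ := exists_eq_exp_image_Ioo hA' hA'o hU
      obtain ⟨s, rfl⟩ := Circle.exp_surjective w
      -- `φ_{-1}(A') = exp(i·(-b,-a))`, `w A' = exp(i·(s+a, s+b))`
      rw [phi_image_exp_image, exp_smul_exp_image, image_const_add_Ioo] at hsym
      push_cast at hsym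
      rw [image_neg_one_mul_Ioo' a b] at hsym
      -- integer shift: `-b + 2πk = s + a`
      obtain ⟨k, hk⟩ := exists_int_shift_Ioo_subset (by linarith) (by linarith) hsym.le
      have hk' := (Ioo_subset_Ioo_iff (by linarith : -b + k * (2 * π) < -a + k * (2 * π))).mp hk
      have hs : s = -(a + b) + k * (2 * π) := by linarith [hk'.1, hk'.2]
      -- `wⁿ = 1` gives `n s ∈ 2πℤ`
      rw [← Circle.exp_nsmul, nsmul_eq_mul, Circle.exp_eq_one] at hwn
      obtain ⟨m, hm⟩ := hwn
      -- the midpoint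
      refine ⟨phi n (Circle.exp ((a + b) / 2)), ⟨Circle.exp ((a + b) / 2),
        hA'A ⟨(a + b) / 2, ⟨by linarith, by linarith⟩, rfl⟩, rfl⟩, ?_⟩
      rw [phi_exp]
      have : ((n : ℤ) : ℝ) * ((a + b) / 2) = ((n * k - m : ℤ) : ℝ) * π := by
        push_cast
        have := hm
        rw [hs] at this
        linarith
      rw [this]
      exact exp_int_mul_pi_mem _
  · rintro ⟨_, ⟨z, hz, rfl⟩, hz1⟩
    obtain ⟨t, rfl⟩ := Circle.exp_surjective z
    obtain ⟨ε, hε, hsub⟩ := exists_arc_subset hAo hz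
    refine ⟨Circle.exp '' Ioo (t - ε) (t + ε), isConnected_exp_image_Ioo (by linarith),
      isOpen_exp_image isOpen_Ioo, hsub, Circle.exp (-(2 * t)), ?_, ?_⟩
    · -- `exp(-2t)ⁿ = (exp(nt))⁻² = 1`
      rw [phi_exp] at hz1
      have h2 : Circle.exp (((n : ℤ) : ℝ) * t) ^ (2 : ℤ) = 1 := by
        rcases hz1 with h | h
        · rw [h, one_zpow]
        · rw [mem_singleton_iff] at h
          rw [h]
          exact even_two.neg_one_zpow
      rw [← Circle.exp_zsmul, zsmul_eq_mul] at h2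
      push_cast at h2
      rw [← Circle.exp_nsmul, nsmul_eq_mul]
      have : (n : ℝ) * (-(2 * t)) = -(2 * (n * t)) := by ring
      rw [this, Circle.exp_neg, h2, inv_one]
    · rw [phi_image_exp_image, exp_smul_exp_image, image_const_add_Ioo]
      push_cast
      rw [image_neg_one_mul_Ioo']
      congr 1
      ring

end CircleOpens

end

end Literature.AlgebraicGeometry.Frobenioids
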